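import Summits.Langlands.Langlands.Theorems.IrreducibilityBySelfDualityIrreducibleOffSectorOfWeak
import Summits.Langlands.Langlands.Theorems.IrreducibilityBySelfDualityIrreducibleOffSectorNonAutomorphicConstituent
import HarnessLib

/-!
# `IrreducibleOffSector` — the weak bootstrap needs weak automorphy only in ranks `2 ≤ m < n`
(crux stmt-Langlands-14329 `IrreducibilityBySelfDuality.IrreducibleOffSector`, line `Sketch`;
`--supports` file, STRUCTURAL: no import of the route module; continuation lead c8, CONSTITUENT package)

The pointwise weak bootstrap `isIrreducible_of_geometric_of_weakAutomorphyBelow` (p112357) derives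
the crux at `(π, ι)` from ONE pinned-geometric a.e.-compatible avatar `ρ₀` (W) and weak automorphy
(B_w) of irreducible pinned-geometric representations of EVERY rank `0 < m < n`.  With the
constituent theorem `exists_block_not_weaklyAutomorphic_of_rational` (p130708) the rank-one case of
(B_w) drops out as soon as `ρ₀` is `E`-rational (Böckle–Hui 2025 Thm. 1.1 supplies the Hecke
characters): 

* `isIrreducible_of_rational_geometric_of_weakAutomorphy_two_le` — granted (2.2)–(2.3), `hWA`
  (the `WeakAbelianSummandHecke` text), ONE avatar `ρ₀` of `π` that is unramified a.e., de Rham above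
  `ℓ` (pinned datum), a.e.-compatible and `E`-rational a.e., and weak automorphy of irreducible
  pinned-geometric `r : Γ_K → GL_m(ℚ̄_ℓ)` for `2 ≤ m < n` only, every a.e.-compatible `ρ` is
  irreducible;
* `isIrreducible_rank_three_of_rational_geometric_of_weakAutomorphy_two` — rank three: the crux at
  `(π, ι)` follows from one `E`-rational geometric avatar and weak automorphy of irreducible geometric
  TWO-dimensional representations of `Γ_K` (no (2.3) hypothesis: ranks `≤ 2` are theorems);
* `irreducibleOffSector_text_of_rational_weak_two_le` — the item's text VERBATIM from (2.2), (2.3),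
  `hWA`, `E`-rational weak existence (W_rat: for L-algebraic cuspidal `π` a geometric avatar with
  Frobenius polynomials over a number field — Buzzard–Gee 3.2.2 with 3.1.6) and weak automorphy of
  irreducible geometric representations in ranks `≥ 2` (Fontaine–Mazur–Langlands, weak form).

References: F. Calegari, T. Gee, Ann. Inst. Fourier 63 (2013), §1.1; G. Böckle, C.-Y. Hui, Math. Ann.
393 (2025), Thm. 1.1; K. Buzzard, T. Gee, LMS LNS 414 (2014), Conj. 3.1.6, 3.2.2; J.-M. Fontaine,
B. Mazur, *Geometric Galois representations* (1995), Conj. 1.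
-/

noncomputable section

set_option linter.dupNamespace false

open scoped NumberField Classical Polynomial
open Filter IsDedekindDomain Polynomial NumberField
open Literature.NumberTheory.Automorphic Literature.NumberTheory.GaloisRepresentations
open Summit.Langlands

namespace Summit.Langlands.Langlands.Theorems.IrreducibleOffSector

/-- **The pointwise weak bootstrap with weak automorphy only in ranks `2 ≤ m < n`.**  Grant
Arthur–Clozel (2.2)–(2.3) for Borel–Jacquet data and Böckle–Hui 2025 Thm. 1.1 in cofinite `GL(1)` form
(`hWA`).  Let `π` be cuspidal on `GL_n(𝔸_K)` (`n ≥ 1`) with ONE avatar `ρ₀` that is unramified almost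
everywhere, de Rham above `ℓ` for Fontaine's pinned datum, Satake–Frobenius compatible with `(π, ι)`
a.e. and `E`-rational a.e., and suppose irreducible such representations of ranks `2 ≤ m < n` are
weakly automorphic.  Then every `ρ` Satake–Frobenius compatible with `(π, ι)` a.e. is irreducible:
the pinned-geometric constituents of `ρ₀` (`ReciprocityUpToIrreducibility.exists_geometricConstituents`)
are one — and `ρ₀` is irreducible — or at least two, each of rank `< n`, and then
`exists_block_not_weaklyAutomorphic_of_rational` produces a constituent of rank `≥ 2` that is not
weakly automorphic, against the hypothesis; irreducibility passes to `ρ` by Chebotarev–Brauer–Nesbitt.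
[cite: CalegariGee2013, §1.1] [cite: BockleHui2025, Theorem 1.1 and §3.2.1] -/
theorem isIrreducible_of_rational_geometric_of_weakAutomorphy_two_le
    (hWA : ∀ (K : Type) [Field K] [NumberField K] (h1 : isCompact_glFiniteIntegralLevel 1 K) (ℓ : ℕ) [Fact ℓ.Prime] (n : ℕ) (E : Type) [Field E] [NumberField E] (e : E →+* PadicAlgCl ℓ) (ρ : Literature.NumberTheory.GaloisRepresentations.FramedGaloisRep K (PadicAlgCl ℓ) n), ρ.toGaloisRep.IsSemisimple → (∀ᶠ v in cofinite, ρ.IsUnramifiedAt v ∧ ∃ P : Polynomial E, ρ.HasFrobCharpolyAt v (P.map e)) → ∀ (ψ : Literature.NumberTheory.GaloisRepresentations.FramedGaloisRep K (PadicAlgCl ℓ) 1), (∀ᶠ v in cofinite, ρ.IsUnramifiedAt v ∧ ψ.IsUnramifiedAt v ∧ ∀ 𝔓 ∈ v.primesAbove, ∀ σ : Field.absoluteGaloisGroup K, IsArithFrobAt (NumberField.RingOfIntegers K) σ 𝔓 → ψ.charpoly σ ∣ ρ.charpoly σ) → ∀ (ι : PadicAlgCl ℓ ≃+* ℂ), ∃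 χ : Literature.NumberTheory.Automorphic.CuspidalAutomorphicRepData 1 K h1, χ.1.IsRegularAlgebraic ∧ ∀ᶠ v in cofinite, ∃ c : ℂ, χ.1.HasSatakeParamAt v {c} ∧ ψ.IsUnramifiedAt v ∧ ψ.HasFrobCharpolyAt v (Literature.NumberTheory.Automorphic.arithFrobPolyOfSatake ι v.residueCard 1 {c}))
    (h22 : JacquetShalika1981_partialPairL_boundary_repData)
    (h23 : JacquetShalika1981_partialPairL_pole_repData)
    {K : Type} [Field K] [NumberField K] {n : ℕ} {hcpt : isCompact_glFiniteIntegralLevel n K}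
    (hn : 0 < n) (π : CuspidalAutomorphicRepData n K hcpt) {ℓ : ℕ} [Fact ℓ.Prime]
    (ι : PadicAlgCl ℓ ≃+* ℂ) {E : Type} [Field E] [NumberField E] (e : E →+* PadicAlgCl ℓ)
    {ρ₀ : FramedGaloisRep K (PadicAlgCl ℓ) n}
    (hgeo₀ : (∀ᶠ v : HeightOneSpectrum (𝓞 K) in cofinite, ρ₀.IsUnramifiedAt v) ∧
      ∀ (v : HeightOneSpectrum (𝓞 K)) (hv : ((ℓ : ℕ) : 𝓞 K) ∈ v.asIdeal),
        (Literature.NumberTheory.PAdicHodge.fontainePstAdicCompletion v ℓ hv).IsDeRhamFramed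
          (ρ₀.toLocal v))
    (hρ₀ : ∀ᶠ v : HeightOneSpectrum (𝓞 K) in cofinite, SatakeFrobCompatibleAt ι π.1 ρ₀ v)
    (hrat₀ : ∀ᶠ v : HeightOneSpectrum (𝓞 K) in cofinite,
      ρ₀.IsUnramifiedAt v ∧ ∃ P : Polynomial E, ρ₀.HasFrobCharpolyAt v (P.map e))
    (hBw : ∀ m : ℕ, 2 ≤ m → m < n → ∀ (hm : isCompact_glFiniteIntegralLevel m K)
      (r : FramedGaloisRep K (PadicAlgCl ℓ) m), r.toGaloisRep.IsIrreducible →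
      ((∀ᶠ v : HeightOneSpectrum (𝓞 K) in cofinite, r.IsUnramifiedAt v) ∧
        ∀ (v : HeightOneSpectrum (𝓞 K)) (hv : ((ℓ : ℕ) : 𝓞 K) ∈ v.asIdeal),
          (Literature.NumberTheory.PAdicHodge.fontainePstAdicCompletion v ℓ hv).IsDeRhamFramed
            (r.toLocal v)) →
      ∃ σ : CuspidalAutomorphicRepData m K hm,
        ∀ᶠ v : HeightOneSpectrum (𝓞 K) in cofinite, SatakeFrobCompatibleAt ι σ.1 r v)
    (ρ : FramedGaloisRep K (PadicAlgCl ℓ) n)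
    (hρ : ∀ᶠ v : HeightOneSpectrum (𝓞 K) in cofinite, SatakeFrobCompatibleAt ι π.1 ρ v) :
    ρ.toGaloisRep.IsIrreducible := by
  suffices hirr₀ : ρ₀.toGaloisRep.IsIrreducible from
    isIrreducible_of_satakeFrobCompatible π.1 ι hirr₀ hρ₀ hρ
  -- the pinned-geometric constituents of `ρ₀`
  obtain ⟨k, m, r, -, hr, hchar, -, hone⟩ :=
    Summit.Langlands.Langlands.Theorems.ReciprocityUpToIrreducibility.exists_geometricConstituents
      Summit.Langlands.Langlands.Theorems.ReciprocityUpToIrreducibility.stub_deRhamBlocks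
      K ℓ ρ₀ hn hgeo₀
  by_cases hk1 : k = 1
  · exact hone hk1
  have hk2 : 2 ≤ k := by
    rcases Nat.lt_or_ge k 2 with hlt | hge
    · interval_cases k
      · have hsum := sum_rank_eq_of_charpoly_eq_prod ρ₀ r 1 (hchar 1)
        simp at hsum
        omega
      · exact absurd rfl hk1
    · exact hge
  have hsum : ∑ i, m i = n := sum_rank_eq_of_charpoly_eq_prod ρ₀ r 1 (hchar 1)
  have hlt : ∀ i, m i < n := rank_lt_of_two_le hsum hk2 fun i => (hr i).1
  -- some constituent of rank `≥ 2` is not weakly automorphic — against (B_w) in its rank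
  obtain ⟨i, hi2, hno⟩ := exists_block_not_weaklyAutomorphic_of_rational hWA h22 hn π ι e ρ₀ hρ₀
    hrat₀ hk2 (fun i => (hr i).1) (fun i => isCompact_glFiniteIntegralLevel_holds (m i) K)
    (fun i _ τ τ' => h23 (m i) K _ (hr i).1 τ τ') r hchar
  obtain ⟨σ, hσ⟩ := hBw (m i) hi2 (hlt i) _ (r i) (hr i).2.1 (hr i).2.2
  exact (hno σ hσ).elim

/-- **Rank three: the crux at `(π, ι)` from one `E`-rational geometric avatar and weak automorphy of
irreducible geometric TWO-dimensional representations** (every `K`, every cuspidal `π` on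
`GL_3(𝔸_K)`; Arthur–Clozel (2.3) is needed in ranks `≤ 2` only, where it is a theorem of the tree).
[cite: CalegariGee2013, §1.1] [cite: BockleHui2025, Theorem 1.1 and §3.2.1] -/
theorem isIrreducible_rank_three_of_rational_geometric_of_weakAutomorphy_two
    (hWA : ∀ (K : Type) [Field K] [NumberField K] (h1 : isCompact_glFiniteIntegralLevel 1 K) (ℓ : ℕ) [Fact ℓ.Prime] (n : ℕ) (E : Type) [Field E] [NumberField E] (e : E →+* PadicAlgCl ℓ) (ρ : Literature.NumberTheory.GaloisRepresentations.FramedGaloisRep K (PadicAlgCl ℓ) n), ρ.toGaloisRep.IsSemisimple → (∀ᶠ v in cofinite, ρ.IsUnramifiedAt v ∧ ∃ P : Polynomial E, ρ.HasFrobCharpolyAt v (P.map e)) → ∀ (ψ : Literature.NumberTheory.GaloisRepresentations.FramedGaloisRep K (PadicAlgCl ℓ) 1), (∀ᶠ v in cofinite, ρ.IsUnramifiedAt v ∧ ψ.IsUnramifiedAt v ∧ ∀ 𝔓 ∈ v.primesAbove, ∀ σ : Field.absoluteGaloisGroup K, IsArithFrobAt (NumberField.RingOfIntegers K) σ 𝔓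 → ψ.charpoly σ ∣ ρ.charpoly σ) → ∀ (ι : PadicAlgCl ℓ ≃+* ℂ), ∃ χ : Literature.NumberTheory.Automorphic.CuspidalAutomorphicRepData 1 K h1, χ.1.IsRegularAlgebraic ∧ ∀ᶠ v in cofinite, ∃ c : ℂ, χ.1.HasSatakeParamAt v {c} ∧ ψ.IsUnramifiedAt v ∧ ψ.HasFrobCharpolyAt v (Literature.NumberTheory.Automorphic.arithFrobPolyOfSatake ι v.residueCard 1 {c}))
    (h22 : JacquetShalika1981_partialPairL_boundary_repData)
    {K : Type} [Field K] [NumberField K] {hcpt : isCompact_glFiniteIntegralLevel 3 K}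
    (π : CuspidalAutomorphicRepData 3 K hcpt) {ℓ : ℕ} [Fact ℓ.Prime]
    (ι : PadicAlgCl ℓ ≃+* ℂ) {E : Type} [Field E] [NumberField E] (e : E →+* PadicAlgCl ℓ)
    {ρ₀ : FramedGaloisRep K (PadicAlgCl ℓ) 3}
    (hgeo₀ : (∀ᶠ v : HeightOneSpectrum (𝓞 K) in cofinite, ρ₀.IsUnramifiedAt v) ∧
      ∀ (v : HeightOneSpectrum (𝓞 K)) (hv : ((ℓ : ℕ) : 𝓞 K) ∈ v.asIdeal),
        (Literature.NumberTheory.PAdicHodge.fontainePstAdicCompletion v ℓ hv).IsDeRhamFramed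
          (ρ₀.toLocal v))
    (hρ₀ : ∀ᶠ v : HeightOneSpectrum (𝓞 K) in cofinite, SatakeFrobCompatibleAt ι π.1 ρ₀ v)
    (hrat₀ : ∀ᶠ v : HeightOneSpectrum (𝓞 K) in cofinite,
      ρ₀.IsUnramifiedAt v ∧ ∃ P : Polynomial E, ρ₀.HasFrobCharpolyAt v (P.map e))
    (hBw2 : ∀ (h2 : isCompact_glFiniteIntegralLevel 2 K) (r : FramedGaloisRep K (PadicAlgCl ℓ) 2),
      r.toGaloisRep.IsIrreducible →
      ((∀ᶠ v : HeightOneSpectrum (𝓞 K) in cofinite, r.IsUnramifiedAt v) ∧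
        ∀ (v : HeightOneSpectrum (𝓞 K)) (hv : ((ℓ : ℕ) : 𝓞 K) ∈ v.asIdeal),
          (Literature.NumberTheory.PAdicHodge.fontainePstAdicCompletion v ℓ hv).IsDeRhamFramed
            (r.toLocal v)) →
      ∃ σ : CuspidalAutomorphicRepData 2 K h2,
        ∀ᶠ v : HeightOneSpectrum (𝓞 K) in cofinite, SatakeFrobCompatibleAt ι σ.1 r v)
    (ρ : FramedGaloisRep K (PadicAlgCl ℓ) 3)
    (hρ : ∀ᶠ v : HeightOneSpectrum (𝓞 K) in cofinite, SatakeFrobCompatibleAt ι π.1 ρ v) :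
    ρ.toGaloisRep.IsIrreducible := by
  suffices hirr₀ : ρ₀.toGaloisRep.IsIrreducible from
    isIrreducible_of_satakeFrobCompatible π.1 ι hirr₀ hρ₀ hρ
  obtain ⟨k, m, r, -, hr, hchar, -, hone⟩ :=
    Summit.Langlands.Langlands.Theorems.ReciprocityUpToIrreducibility.exists_geometricConstituents
      Summit.Langlands.Langlands.Theorems.ReciprocityUpToIrreducibility.stub_deRhamBlocks
      K ℓ ρ₀ three_pos hgeo₀
  by_cases hk1 : k = 1
  · exact hone hk1
  have hk2 : 2 ≤ k := by
    rcases Nat.lt_or_ge k 2 with hlt | hge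
    · interval_cases k
      · have hsum := sum_rank_eq_of_charpoly_eq_prod ρ₀ r 1 (hchar 1)
        simp at hsum
      · exact absurd rfl hk1
    · exact hge
  have hsum : ∑ i, m i = 3 := sum_rank_eq_of_charpoly_eq_prod ρ₀ r 1 (hchar 1)
  have hlt : ∀ i, m i < 3 := rank_lt_of_two_le hsum hk2 fun i => (hr i).1
  obtain ⟨i, hi2, hno⟩ := exists_block_not_weaklyAutomorphic_of_rational hWA h22 three_pos π ι e ρ₀
    hρ₀ hrat₀ hk2 (fun i => (hr i).1) (fun i => isCompact_glFiniteIntegralLevel_holds (m i) K)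
    (fun i h3 => absurd (hlt i) (by omega)) r hchar
  have hmi : m i = 2 := by have := hlt i; omega
  -- transport (B_w) in rank two to the nominal rank `m i = 2` of the constituent
  have key : ∀ (d : ℕ), d = 2 → ∀ (r' : FramedGaloisRep K (PadicAlgCl ℓ) d),
      r'.toGaloisRep.IsIrreducible →
      ((∀ᶠ v : HeightOneSpectrum (𝓞 K) in cofinite, r'.IsUnramifiedAt v) ∧
        ∀ (v : HeightOneSpectrum (𝓞 K)) (hv : ((ℓ : ℕ) : 𝓞 K) ∈ v.asIdeal),
          (Literature.NumberTheory.PAdicHodge.fontainePstAdicCompletion v ℓ hv).IsDeRhamFramed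
            (r'.toLocal v)) →
      ∃ σ : CuspidalAutomorphicRepData d K (isCompact_glFiniteIntegralLevel_holds d K),
        ∀ᶠ v : HeightOneSpectrum (𝓞 K) in cofinite, SatakeFrobCompatibleAt ι σ.1 r' v := by
    intro d hd r' hirr hgeo
    subst hd
    exact hBw2 _ r' hirr hgeo
  obtain ⟨σ, hσ⟩ := key (m i) hmi (r i) (hr i).2.1 (hr i).2.2
  exact (hno σ hσ).elim

/-- **The route item `IrreducibleOffSector` from `E`-rational weak existence and weak automorphy in
ranks `≥ 2`** (structural form, the item's text VERBATIM as conclusion).  Hypotheses: Arthur–Clozel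
(2.2)–(2.3); Böckle–Hui Thm. 1.1 (`hWA`, the `WeakAbelianSummandHecke` text); (W_rat) every L-algebraic
cuspidal `π` on `GL_n(𝔸_K)` has, for all `ℓ, ι`, an avatar unramified a.e., de Rham above `ℓ` (pinned
datum), Satake–Frobenius compatible a.e. AND with Frobenius polynomials over some number field
`E →+* ℚ̄_ℓ` a.e. (Buzzard–Gee 3.2.2 with the arithmeticity of 3.1.6); (B_w, ranks `≥ 2`) every
irreducible such representation of rank `n ≥ 2` is Satake–Frobenius compatible a.e. with some cuspidal
datum on `GL_n(𝔸_K)`.  Compared with `irreducibleOffSector_text_of_weak` (p112357) weak automorphy of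
geometric CHARACTERS is no longer asked (it is Böckle–Hui's theorem, given `E`-rationality).
[cite: CalegariGee2013, §1.1] [cite: BuzzardGeeLMS2014, Conj. 3.1.6 and 3.2.2] -/
theorem irreducibleOffSector_text_of_rational_weak_two_le
    (hWA : ∀ (K : Type) [Field K] [NumberField K] (h1 : isCompact_glFiniteIntegralLevel 1 K) (ℓ : ℕ) [Fact ℓ.Prime] (n : ℕ) (E : Type) [Field E] [NumberField E] (e : E →+* PadicAlgCl ℓ) (ρ : Literature.NumberTheory.GaloisRepresentations.FramedGaloisRep K (PadicAlgCl ℓ) n), ρ.toGaloisRep.IsSemisimple → (∀ᶠ v in cofinite, ρ.IsUnramifiedAt v ∧ ∃ P : Polynomial E, ρ.HasFrobCharpolyAt v (P.map e)) → ∀ (ψ : Literature.NumberTheory.GaloisRepresentations.FramedGaloisRep K (PadicAlgCl ℓ) 1), (∀ᶠ v in cofinite, ρ.IsUnramifiedAt v ∧ ψ.IsUnramifiedAt v ∧ ∀ 𝔓 ∈ v.primesAbove, ∀ σ : Field.absoluteGaloisGroup K, IsArithFrobAt (NumberField.RingOfIntegers K) σ 𝔓 → ψ.charpoly σ ∣ ρ.charpoly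 σ) → ∀ (ι : PadicAlgCl ℓ ≃+* ℂ), ∃ χ : Literature.NumberTheory.Automorphic.CuspidalAutomorphicRepData 1 K h1, χ.1.IsRegularAlgebraic ∧ ∀ᶠ v in cofinite, ∃ c : ℂ, χ.1.HasSatakeParamAt v {c} ∧ ψ.IsUnramifiedAt v ∧ ψ.HasFrobCharpolyAt v (Literature.NumberTheory.Automorphic.arithFrobPolyOfSatake ι v.residueCard 1 {c}))
    (h22 : JacquetShalika1981_partialPairL_boundary_repData)
    (h23 : JacquetShalika1981_partialPairL_pole_repData)
    (hWrat : ∀ (K : Type) [Field K] [NumberField K] (n : ℕ) (hcpt : isCompact_glFiniteIntegralLevel n K), 0 < n → ∀ π : CuspidalAutomorphicRepData n K hcpt, π.1.IsLAlgebraic → ∀ (ℓ : ℕ) [Fact ℓ.Prime] (ι : PadicAlgCl ℓ ≃+* ℂ), ∃ ρ : FramedGaloisRep K (PadicAlgCl ℓ) n, ((∀ᶠ v : HeightOneSpectrum (𝓞 K) in cofinite, ρ.IsUnramifiedAt v) ∧ ∀ (v : HeightOneSpectrum (𝓞 K)) (hv : ((ℓ : ℕ) : 𝓞 K) ∈ v.asIdeal),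 (Literature.NumberTheory.PAdicHodge.fontainePstAdicCompletion v ℓ hv).IsDeRhamFramed (ρ.toLocal v)) ∧ (∀ᶠ v : HeightOneSpectrum (𝓞 K) in cofinite, SatakeFrobCompatibleAt ι π.1 ρ v) ∧ ∃ (E : Type) (_ : Field E) (_ : NumberField E) (e : E →+* PadicAlgCl ℓ), ∀ᶠ v : HeightOneSpectrum (𝓞 K) in cofinite, ρ.IsUnramifiedAt v ∧ ∃ P : Polynomial E, ρ.HasFrobCharpolyAt v (P.map e))
    (hBw2 : ∀ (K : Type) [Field K] [NumberField K] (n : ℕ) (hcpt : isCompact_glFiniteIntegralLevel n K), 2 ≤ n → ∀ (ℓ : ℕ) [Fact ℓ.Prime] (ι : PadicAlgCl ℓ ≃+* ℂ) (ρ : FramedGaloisRep K (PadicAlgCl ℓ) n), ρ.toGaloisRep.IsIrreducible → ((∀ᶠ v : HeightOneSpectrum (𝓞 K) in cofinite, ρ.IsUnramifiedAt v) ∧ ∀ (v : HeightOneSpectrum (𝓞 K)) (hv : ((ℓ : ℕ) : 𝓞 K) ∈ v.asIdeal), (Literature.NumberTheory.PAdicHodge.fontainePstAdicCompletion v ℓ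 hv).IsDeRhamFramed (ρ.toLocal v)) → ∃ π : CuspidalAutomorphicRepData n K hcpt, ∀ᶠ v : HeightOneSpectrum (𝓞 K) in cofinite, SatakeFrobCompatibleAt ι π.1 ρ v) :
    ∀ (n : ℕ) (K : Type) [Field K] [NumberField K] (hcpt : Literature.NumberTheory.Automorphic.isCompact_glFiniteIntegralLevel n K), 0 < n → ∀ (π : Literature.NumberTheory.Automorphic.CuspidalAutomorphicRepData n K hcpt), π.1.IsLAlgebraic → ¬ (n = 3 ∧ NumberField.IsCMField K ∧ ∃ T : Literature.NumberTheory.Automorphic.InfinityType K n, π.1.HasInfinityType T ∧ T.IsRegular) → ∀ (ℓ : ℕ) [Fact ℓ.Prime] (ι : PadicAlgCl ℓ ≃+* ℂ) (ρ : Literature.NumberTheory.GaloisRepresentations.FramedGaloisRep K (PadicAlgCl ℓ) n), (∀ᶠ v : IsDedekindDomain.HeightOneSpectrum (NumberField.RingOfIntegers K) in cofinite, SatakeFrobCompatibleAt ι π.1 ρ v) → ρ.toGaloisRep.IsIrreducible := by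
  intro n K _ _ hcpt hn π hL _ ℓ _ ι ρ hρ
  obtain ⟨ρ₀, hgeo₀, hρ₀, E, _, _, e, hrat₀⟩ := hWrat K n hcpt hn π hL ℓ ι
  exact isIrreducible_of_rational_geometric_of_weakAutomorphy_two_le hWA h22 h23 hn π ι e hgeo₀ hρ₀
    hrat₀ (fun m hm2 _ hcm r hirr hgeo => hBw2 K m hcm hm2 ℓ ι r hirr hgeo) ρ hρ

end Summit.Langlands.Langlands.Theorems.IrreducibleOffSector

end
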